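import Mathlib
import Literature.Analysis.FluidPDE.TypeIAncientMild
import Literature.Analysis.FluidPDE.OseenSlice
import HarnessLib

/-!
# Route SymmetryModuliCount — crux `HelicalEndLiouville` (stmt-NavierStokesRegularity-14062),
# line `vanishing-cell-reynolds`, stub 5 (the hardest): absorption of the cell oscillation
# (`stub_cellAbsorption`)

Write `Π₀ h (x) = ∫₀¹ h (x + rL) dr` for the cell mean along the period vector `L` and
`w = (I − Π₀) u` for the cell oscillation of an `L`-periodic Type-I ancient mild field `u ∈ A_C`
(`IsTypeIAncientMild C u`, periodic on the end `t < θ ≤ 0`). Hypotheses (the three earlier stubs,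
taken as data with arbitrary real constants `κ`, `K`): (H1) the heat cell gap
`‖(I − Π₀) e^{σΔ} g‖ ≤ κ (‖L‖²/σ) M`; (H2) the oscillation form of the mild identity
`w(t') = (I − Π₀)e^{(t'−s)Δ}u(s) − ∫_{(s,t')} (I − Π₀) N_{t'−τ}[u τ, u τ] dτ`; (H3) the linear
oscillation bound `‖(I − Π₀) N_σ[f,f]‖ ≤ K min(σ^{-1/2}, ‖L‖²σ^{-3/2}) M S` for `L`-periodic `f`
with `‖f‖ ≤ M`, `‖(I − Π₀)f‖ ≤ S`. Conclusion: for `t < θ` with `t < −(8KC‖L‖)²`, `u(t)` is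
invariant under all translations along `L`.

Proof (no supremum is taken; a geometric iteration instead). Put `W₀ = 2C/√(−t)` and
`q = 4|K|C‖L‖/√(−t) ≤ 1/2` (threshold). CLAIM: `‖w(t', y)‖ ≤ qⁿ W₀` for all `t' ≤ t`, all `y`,
all `n`. For `n = 0` this is the Type-I bound (`‖Π₀ u‖ ≤ C/√(−t')`). Step `n → n+1`: for
`s < t'`, (H2) and (H1) (with `g = u(s)`, bound `C/√(−s)`) give a free term
`≤ |κ|‖L‖²C (t'−s)⁻¹ (√(−s))⁻¹ =: ε(s) → 0` as `s → −∞`; (H3) at `τ ∈ (s,t')` with `M = C/√(−t')`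
(`norm_le_of_mem_Ioo`) and `S = qⁿW₀` (induction hypothesis at `τ ≤ t`) bounds the Duhamel
integrand by `|K| M S · gk(t'−τ)`, `gk σ = min(σ^{-1/2}, ‖L‖²σ^{-3/2})`, whose time integral is
`≤ 4‖L‖` (`∫₀^{‖L‖²} σ^{-1/2} + ∫_{‖L‖²}^∞ ‖L‖²σ^{-3/2} = 2‖L‖ + 2‖L‖`, two `integral_rpow`); so
`‖w(t',y)‖ ≤ ε(s) + 4|K|‖L‖ (C/√(−t')) qⁿW₀ ≤ ε(s) + q^{n+1}W₀`, and `s → −∞` (`ge_of_tendsto`).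
Hence `w(t, ·) = 0` (`qⁿW₀ → 0`), i.e. `u(t) = Π₀ u(t)`, which is invariant under all
translations along `L` (`Function.Periodic.intervalIntegral_add_eq`).

Where the hypotheses of the crux enter: mildness from `−∞` (the free term is flushed only as
`s → −∞`), the Type-I bound on the WHOLE past of `t` (`W₀ < ∞` and `M`), periodicity (feeds H1/H3);
`L ≠ 0` only to place the split point `‖L‖² > 0`. Tree lemmas: `TypeIAncientMild.lean`,
`OseenSlice.lean` (objects only), Mathlib (`integral_rpow`, `intervalIntegral.integral_comp_sub_left`,
`norm_integral_le_of_norm_le`, `tendsto_pow_atTop_nhds_zero_of_lt_one`). The statement is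
elementary bookkeeping over (H1)–(H3) (folklore; the gap/absorption mechanism is that of
G. Raugel–G. Sell thin-domain theory and of KNSS 2009 §5 in spirit, but no printed source is used).
Candidate proof prepared by refuter-drefute-stmt-NavierStokesRegularity-14062-g2-0 (positive
by-product of the stub-set attack; `lean check` rc 0, 0 sorries, axioms
{propext, Classical.choice, Quot.sound}).
-/

noncomputable section

-- the summit and its single sub-problem share the name (CONVENTIONS §1), as in every Theorems file
set_option linter.dupNamespace false

open Set MeasureTheory Function Filter intervalIntegral
open Literature.Analysis.FluidPDE
open Literature.Analysis.UnboundedOperators (heatExtension)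
open scoped RealInnerProductSpace Topology

namespace Summit.NavierStokesRegularity.NavierStokesRegularity.Theorems

local notation "E3" => EuclideanSpace ℝ (Fin 3)

/-! ## The gapped kernel majorant and its mass -/

/-- The gapped kernel majorant `min(σ^{-1/2}, ℓ² σ^{-3/2})`. [folklore] -/
def cellAbsorption_gk (ℓ σ : ℝ) : ℝ := min (σ ^ (-(1 / 2 : ℝ))) (ℓ ^ 2 * σ ^ (-(3 / 2 : ℝ)))

/-- Elementary helper for `stub_cellAbsorption`. [folklore] -/
theorem cellAbsorption_gk_def (ℓ σ : ℝ) : cellAbsorption_gk ℓ σ = min (σ ^ (-(1 / 2 : ℝ))) (ℓ ^ 2 * σ ^ (-(3 / 2 : ℝ))) := rfl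

/-- Elementary helper for `stub_cellAbsorption`. [folklore] -/
theorem cellAbsorption_measurable_gk (ℓ : ℝ) : Measurable (cellAbsorption_gk ℓ) :=
  (measurable_id.pow_const _).min ((measurable_id.pow_const _).const_mul _)

/-- Elementary helper for `stub_cellAbsorption`. [folklore] -/
theorem cellAbsorption_gk_nonneg {ℓ σ : ℝ} (hσ : 0 ≤ σ) : 0 ≤ cellAbsorption_gk ℓ σ :=
  le_min (Real.rpow_nonneg hσ _) (mul_nonneg (sq_nonneg _) (Real.rpow_nonneg hσ _))

/-- Elementary helper for `stub_cellAbsorption`. [folklore] -/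
theorem cellAbsorption_gk_le_left (ℓ σ : ℝ) : cellAbsorption_gk ℓ σ ≤ σ ^ (-(1 / 2 : ℝ)) := min_le_left _ _

/-- Elementary helper for `stub_cellAbsorption`. [folklore] -/
theorem cellAbsorption_gk_le_right (ℓ σ : ℝ) : cellAbsorption_gk ℓ σ ≤ ℓ ^ 2 * σ ^ (-(3 / 2 : ℝ)) := min_le_right _ _

/-- Elementary helper for `stub_cellAbsorption`. [folklore] -/
theorem cellAbsorption_intervalIntegrable_rpow_neg_half (a b : ℝ) :
    IntervalIntegrable (fun σ : ℝ => σ ^ (-(1 / 2 : ℝ))) volume a b :=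
  intervalIntegral.intervalIntegrable_rpow' (by norm_num)

/-- `cellAbsorption_gk ℓ` is interval integrable on `[a, b]` for `0 ≤ a ≤ b` (dominated by `σ^{-1/2}`). [folklore] -/
theorem cellAbsorption_intervalIntegrable_gk (ℓ : ℝ) {a b : ℝ} (ha : 0 ≤ a) (hab : a ≤ b) :
    IntervalIntegrable (cellAbsorption_gk ℓ) volume a b := by
  refine (cellAbsorption_intervalIntegrable_rpow_neg_half a b).mono_fun
    (cellAbsorption_measurable_gk ℓ).aestronglyMeasurable ?_
  rw [uIoc_of_le hab]
  filter_upwards [ae_restrict_mem measurableSet_Ioc] with σ hσ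
  have hσ0 : 0 ≤ σ := ha.trans hσ.1.le
  rw [Real.norm_of_nonneg (cellAbsorption_gk_nonneg hσ0), Real.norm_of_nonneg (Real.rpow_nonneg hσ0 _)]
  exact cellAbsorption_gk_le_left ℓ σ

/-- `∫₀^T σ^{-1/2} dσ = 2 √T` for `T ≥ 0`. [folklore] -/
theorem cellAbsorption_integral_rpow_neg_half (T : ℝ) :
    ∫ σ in (0:ℝ)..T, σ ^ (-(1 / 2 : ℝ)) = 2 * Real.sqrt T := by
  rw [integral_rpow (Or.inl (by norm_num : (-1:ℝ) < -(1 / 2)))]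
  have e1 : (-(1 / 2 : ℝ) + 1) = 1 / 2 := by norm_num
  rw [e1, Real.zero_rpow (by norm_num : (1 / 2 : ℝ) ≠ 0), Real.sqrt_eq_rpow]
  ring

/-- `∫_{a}^{b} σ^{-3/2} dσ = 2 (a^{-1/2} - b^{-1/2})` for `0 < a ≤ b`. [folklore] -/
theorem cellAbsorption_integral_rpow_neg_three_half {a b : ℝ} (ha : 0 < a) (hab : a ≤ b) :
    ∫ σ in a..b, σ ^ (-(3 / 2 : ℝ)) = 2 * (a ^ (-(1 / 2 : ℝ)) - b ^ (-(1 / 2 : ℝ))) := by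
  have h0 : (0:ℝ) ∉ uIcc a b := by
    rw [uIcc_of_le hab]; exact fun h => (lt_irrefl 0) (ha.trans_le h.1)
  rw [integral_rpow (Or.inr ⟨by norm_num, h0⟩)]
  have e1 : (-(3 / 2 : ℝ) + 1) = -(1 / 2) := by norm_num
  rw [e1]
  field_simp
  ring

/-- **Mass of the gapped kernel**: `∫₀^T min(σ^{-1/2}, ℓ² σ^{-3/2}) dσ ≤ 4ℓ` (`ℓ > 0`, `T ≥ 0`). [folklore] -/
theorem cellAbsorption_integral_gk_le {ℓ T : ℝ} (hℓ : 0 < ℓ) (hT : 0 ≤ T) :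
    ∫ σ in (0:ℝ)..T, cellAbsorption_gk ℓ σ ≤ 4 * ℓ := by
  have hsq : Real.sqrt (ℓ ^ 2) = ℓ := Real.sqrt_sq hℓ.le
  -- the near part on `[0, S]`, `S ≤ ℓ²`
  have near : ∀ {S : ℝ}, 0 ≤ S → S ≤ ℓ ^ 2 → ∫ σ in (0:ℝ)..S, cellAbsorption_gk ℓ σ ≤ 2 * ℓ := by
    intro S hS0 hSℓ
    calc ∫ σ in (0:ℝ)..S, cellAbsorption_gk ℓ σ ≤ ∫ σ in (0:ℝ)..S, σ ^ (-(1 / 2 : ℝ)) :=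
          integral_mono_on hS0 (cellAbsorption_intervalIntegrable_gk ℓ le_rfl hS0)
            (cellAbsorption_intervalIntegrable_rpow_neg_half 0 S) (fun σ _ => cellAbsorption_gk_le_left ℓ σ)
      _ = 2 * Real.sqrt S := cellAbsorption_integral_rpow_neg_half S
      _ ≤ 2 * ℓ := by
          have : Real.sqrt S ≤ ℓ := by rw [← hsq]; exact Real.sqrt_le_sqrt hSℓ
          linarith
  rcases le_or_gt T (ℓ ^ 2) with hTl | hTl
  · linarith [near hT hTl]
  · have hℓ2 : 0 < ℓ ^ 2 := by positivity
    have hsplit : ∫ σ in (0:ℝ)..T, cellAbsorption_gk ℓ σ =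
        (∫ σ in (0:ℝ)..ℓ ^ 2, cellAbsorption_gk ℓ σ) + ∫ σ in ℓ ^ 2..T, cellAbsorption_gk ℓ σ :=
      (integral_add_adjacent_intervals (cellAbsorption_intervalIntegrable_gk ℓ le_rfl hℓ2.le)
        (cellAbsorption_intervalIntegrable_gk ℓ hℓ2.le hTl.le)).symm
    have far : ∫ σ in ℓ ^ 2..T, cellAbsorption_gk ℓ σ ≤ 2 * ℓ := by
      calc ∫ σ in ℓ ^ 2..T, cellAbsorption_gk ℓ σ ≤ ∫ σ in ℓ ^ 2..T, ℓ ^ 2 * σ ^ (-(3 / 2 : ℝ)) := by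
            refine integral_mono_on hTl.le (cellAbsorption_intervalIntegrable_gk ℓ hℓ2.le hTl.le) ?_
              (fun σ _ => cellAbsorption_gk_le_right ℓ σ)
            refine ((intervalIntegral.intervalIntegrable_rpow (r := -(3 / 2 : ℝ)) (Or.inr ?_))).const_mul _
            rw [uIcc_of_le hTl.le]; exact fun h => (lt_irrefl 0) (hℓ2.trans_le h.1)
        _ = ℓ ^ 2 * (2 * ((ℓ ^ 2) ^ (-(1 / 2 : ℝ)) - T ^ (-(1 / 2 : ℝ)))) := by
            rw [intervalIntegral.integral_const_mul, cellAbsorption_integral_rpow_neg_three_half hℓ2 hTl.le]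
        _ ≤ ℓ ^ 2 * (2 * (ℓ ^ 2) ^ (-(1 / 2 : ℝ))) := by
            have : 0 ≤ T ^ (-(1 / 2 : ℝ)) := Real.rpow_nonneg hT _
            nlinarith
        _ = 2 * ℓ := by
            have e : (ℓ ^ 2) ^ (-(1 / 2 : ℝ)) = ℓ⁻¹ := by
              rw [show (ℓ ^ 2 : ℝ) = ℓ ^ (2:ℝ) by norm_cast, ← Real.rpow_mul hℓ.le]
              norm_num
              exact Real.rpow_neg_one ℓ
            rw [e]; field_simp
    rw [hsplit]
    linarith [near hℓ2.le le_rfl, far]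


/-! ## The absorption -/

/-- Cell mean of an `L`-periodic field is invariant under all translations along `L`. [folklore] -/
theorem cellAbsorption_mean_transl {f : E3 → E3} {L : E3} (hper : ∀ x, f (x + L) = f x) (x : E3) (s : ℝ) :
    ∫ r in (0:ℝ)..1, f (x + s • L + r • L) = ∫ r in (0:ℝ)..1, f (x + r • L) := by
  have hφ : Periodic (fun r : ℝ => f (x + r • L)) 1 := fun r => by
    simp only [add_smul, one_smul, ← add_assoc]
    exact hper _
  calc ∫ r in (0:ℝ)..1, f (x + s • L + r • L)
      = ∫ r in (0:ℝ)..1, (fun r' : ℝ => f (x + r' • L)) (r + s) := by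
        refine intervalIntegral.integral_congr fun r _ => ?_
        simp only [add_smul]
        congr 1
        abel
    _ = ∫ r in (0:ℝ) + s..1 + s, (fun r' : ℝ => f (x + r' • L)) r :=
        intervalIntegral.integral_comp_add_right (fun r' : ℝ => f (x + r' • L)) s
    _ = ∫ r in s..s + 1, (fun r' : ℝ => f (x + r' • L)) r := by rw [zero_add, add_comm]
    _ = ∫ r in (0:ℝ)..0 + 1, (fun r' : ℝ => f (x + r' • L)) r := hφ.intervalIntegral_add_eq s 0
    _ = ∫ r in (0:ℝ)..1, f (x + r • L) := by rw [zero_add]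

/-- Time integral of the gapped majorant over `(s, t')`: `≤ 4‖L‖`. [folklore] -/
theorem cellAbsorption_setIntegral_gk_sub_le {ℓ s t' : ℝ} (hℓ : 0 < ℓ) (hs : s < t') :
    ∫ τ in Ioo s t', cellAbsorption_gk ℓ (t' - τ) ≤ 4 * ℓ := by
  rw [← integral_Ioc_eq_integral_Ioo, ← intervalIntegral.integral_of_le hs.le,
    intervalIntegral.integral_comp_sub_left (fun σ => cellAbsorption_gk ℓ σ) t', sub_self]
  exact cellAbsorption_integral_gk_le hℓ (by linarith)

/-- Integrability of the gapped majorant `τ ↦ cellAbsorption_gk ℓ (t' - τ)` on `(s, t')`. [folklore] -/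
theorem cellAbsorption_integrableOn_gk_sub (ℓ : ℝ) {s t' : ℝ} (hs : s < t') :
    IntegrableOn (fun τ => cellAbsorption_gk ℓ (t' - τ)) (Ioo s t') := by
  have h := (cellAbsorption_intervalIntegrable_gk ℓ le_rfl (sub_nonneg.2 hs.le)).comp_sub_left t'
  rw [sub_zero, sub_sub_cancel] at h
  exact ((intervalIntegrable_iff_integrableOn_Ioc_of_le hs.le).1 h.symm).mono_set
    Ioo_subset_Ioc_self

/-- **`stub_cellAbsorption`** (verbatim signature of skeleton d4c7fc4e): given the heat cell gap
(constant `κ`), the cell-oscillation form of the mild identity, and the linear-in-`S` Oseen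
oscillation bound (constant `K`), an `L`-periodic element of `A_C` is invariant under ALL
translations along `L` at every time `t < θ` with `t < −(8KC‖L‖)²` (the cell Reynolds number
`4|K|C‖L‖/√(−t)` is below `1/2`, so the oscillation, a priori `≤ 2C/√(−t)` on the whole past of
`t`, is absorbed geometrically to `0`). [folklore] -/
theorem stub_cellAbsorption :
    ∀ κ K : ℝ, (∀ (L : E3) (g : E3 → E3) (M σ : ℝ), Continuous g → (∀ x, g (x + L) = g x) → (∀ x, ‖g x‖ ≤ M) → 0 < σ → ∀ x : E3, ‖heatExtension g σ x - ∫ r in (0:ℝ)..1, heatExtension g σ (x + r • L)‖ ≤ κ * (‖L‖ ^ 2 / σ) * M) → (∀ (C : ℝ) (u : ℝ → E3 → E3), IsTypeIAncientMild C u → ∀ (L : E3) (s t : ℝ), s < t → t < 0 → ∀ x : E3, u t x - (∫ r in (0:ℝ)..1, u t (x + r • L)) = (heatExtension (u s) (t - s) x - ∫ r in (0:ℝ)..1, heatExtension (u s) (t - s) (x + r • L)) - ∫ τ in Set.Ioo s t, (oseenSlice (t - τ) (u τ) (u τ) x - ∫ r in (0:ℝ)..1, oseenSlice (t - τ) (u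 τ) (u τ) (x + r • L))) → (∀ (L : E3) (f : E3 → E3) (M S σ : ℝ), Continuous f → (∀ x, f (x + L) = f x) → (∀ x, ‖f x‖ ≤ M) → (∀ x, ‖f x - ∫ r in (0:ℝ)..1, f (x + r • L)‖ ≤ S) → 0 < σ → ∀ x : E3, ‖oseenSlice σ f f x - ∫ r in (0:ℝ)..1, oseenSlice σ f f (x + r • L)‖ ≤ K * min (σ ^ (-(1 / 2 : ℝ))) (‖L‖ ^ 2 * σ ^ (-(3 / 2 : ℝ))) * M * S) → ∀ (C : ℝ) (u : ℝ → E3 → E3), IsTypeIAncientMild C u → ∀ (L : E3) (θ : ℝ), L ≠ 0 → θ ≤ 0 → (∀ t < θ, ∀ x, u t (x + L) = u t x) → ∀ t < θ, t < -(8 * K * C * ‖L‖) ^ 2 → ∀ (x : E3) (s : ℝ), u t (x + s • L) = u t x := by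
  intro κ K H1 H2 H3 C u hu L θ hL hθ hper t ht hthr x₀ s₀
  have hC : 0 ≤ C := hu.nonneg
  have ht0 : t < 0 := lt_of_lt_of_le ht hθ
  have hℓ0 : 0 < ‖L‖ := norm_pos_iff.2 hL
  have hst : 0 < Real.sqrt (-t) := Real.sqrt_pos.2 (by linarith)
  -- the oscillation, the a-priori bound and the ratio
  set w : ℝ → E3 → E3 := fun t' y => u t' y - ∫ r in (0:ℝ)..1, u t' (y + r • L) with hw
  set W₀ : ℝ := 2 * (C / Real.sqrt (-t)) with hW₀
  set q : ℝ := 4 * |K| * C * ‖L‖ / Real.sqrt (-t) with hq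
  have hW₀0 : 0 ≤ W₀ := by positivity
  have hq0 : 0 ≤ q := by positivity
  have hq1 : q ≤ 1 / 2 := by
    have h1 : 8 * |K| * C * ‖L‖ < Real.sqrt (-t) := by
      rw [Real.lt_sqrt (by positivity)]
      calc (8 * |K| * C * ‖L‖) ^ 2 = (8 * K * C * ‖L‖) ^ 2 := by
            rw [show (8 * |K| * C * ‖L‖) = |8 * K * C * ‖L‖| by
              rw [abs_mul, abs_mul, abs_mul, abs_of_nonneg hC, abs_of_nonneg (norm_nonneg L)]
              norm_num]
            exact sq_abs _
        _ < -t := by linarith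
    rw [hq, div_le_iff₀ hst]
    linarith
  -- decay of the Type-I bound along the past
  have hmono : ∀ t' ≤ t, C / Real.sqrt (-t') ≤ C / Real.sqrt (-t) := fun t' ht' =>
    div_le_div_of_nonneg_left hC hst (Real.sqrt_le_sqrt (by linarith))
  -- the claim: geometric decay of the oscillation on the whole past of `t`
  have claim : ∀ n : ℕ, ∀ t' ≤ t, ∀ y, ‖w t' y‖ ≤ q ^ n * W₀ := by
    intro n
    induction n with
    | zero =>
      intro t' ht' y
      have ht'0 : t' < 0 := lt_of_le_of_lt ht' ht0
      have hb : ∀ z, ‖u t' z‖ ≤ C / Real.sqrt (-t') := fun z => hu.norm_le ht'0 z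
      have hI : ‖∫ r in (0:ℝ)..1, u t' (y + r • L)‖ ≤ C / Real.sqrt (-t') := by
        have h := intervalIntegral.norm_integral_le_of_norm_le_const (a := (0:ℝ)) (b := 1)
          (f := fun r : ℝ => u t' (y + r • L)) (C := C / Real.sqrt (-t')) fun r _ => hb _
        simpa using h
      calc ‖w t' y‖ ≤ ‖u t' y‖ + ‖∫ r in (0:ℝ)..1, u t' (y + r • L)‖ := norm_sub_le _ _
        _ ≤ C / Real.sqrt (-t') + C / Real.sqrt (-t') := add_le_add (hb y) hI
        _ ≤ C / Real.sqrt (-t) + C / Real.sqrt (-t) := add_le_add (hmono t' ht') (hmono t' ht')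
        _ = q ^ 0 * W₀ := by rw [hW₀]; ring
    | succ n ih =>
      intro t' ht' y
      have ht'0 : t' < 0 := lt_of_le_of_lt ht' ht0
      have ht'θ : t' < θ := lt_of_le_of_lt ht' ht
      set S : ℝ := q ^ n * W₀ with hS
      have hS0 : 0 ≤ S := by positivity
      set M : ℝ := C / Real.sqrt (-t') with hM
      have hM0 : 0 ≤ M := div_nonneg hC (Real.sqrt_nonneg _)
      -- the free term
      set ε : ℝ → ℝ := fun s => |κ| * ‖L‖ ^ 2 * C * ((t' - s)⁻¹ * (Real.sqrt (-s))⁻¹) with hε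
      have hεlim : Tendsto ε atBot (𝓝 0) := by
        have h1 : Tendsto (fun s : ℝ => t' - s) atBot atTop := by
          have := tendsto_atTop_add_const_left atBot t' tendsto_neg_atBot_atTop
          simpa [sub_eq_add_neg] using this
        have h2 : Tendsto (fun s : ℝ => Real.sqrt (-s)) atBot atTop :=
          Real.tendsto_sqrt_atTop.comp tendsto_neg_atBot_atTop
        have h3 := ((tendsto_inv_atTop_zero.comp h1).mul (tendsto_inv_atTop_zero.comp h2)).const_mul
          (|κ| * ‖L‖ ^ 2 * C)
        simpa [hε, mul_zero] using h3
      -- the bound for every `s < t'`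
      have hbound : ∀ s < t', ‖w t' y‖ ≤ ε s + q ^ (n + 1) * W₀ := by
        intro s hs
        have hs0 : s < 0 := hs.trans ht'0
        have hsθ : s < θ := hs.trans ht'θ
        -- H2: representation
        have hrep := H2 C u hu L s t' hs ht'0 y
        -- H1: free term
        have hA : ‖heatExtension (u s) (t' - s) y -
            ∫ r in (0:ℝ)..1, heatExtension (u s) (t' - s) (y + r • L)‖ ≤ ε s := by
          have h := H1 L (u s) (C / Real.sqrt (-s)) (t' - s) (hu.continuous_slice hs0) (hper s hsθ)
            (fun z => hu.norm_le hs0 z) (sub_pos.2 hs) y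
          refine h.trans ?_
          have hX : 0 ≤ ‖L‖ ^ 2 / (t' - s) * (C / Real.sqrt (-s)) :=
            mul_nonneg (div_nonneg (sq_nonneg _) (sub_pos.2 hs).le) (div_nonneg hC (Real.sqrt_nonneg _))
          calc κ * (‖L‖ ^ 2 / (t' - s)) * (C / Real.sqrt (-s))
              = κ * (‖L‖ ^ 2 / (t' - s) * (C / Real.sqrt (-s))) := by ring
            _ ≤ |κ| * (‖L‖ ^ 2 / (t' - s) * (C / Real.sqrt (-s))) :=
                mul_le_mul_of_nonneg_right (le_abs_self κ) hX
            _ = ε s := by simp only [hε, div_eq_mul_inv]; ring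
        -- H3: the Duhamel oscillation, pointwise
        have hN : ∀ τ ∈ Ioo s t', ‖oseenSlice (t' - τ) (u τ) (u τ) y -
            ∫ r in (0:ℝ)..1, oseenSlice (t' - τ) (u τ) (u τ) (y + r • L)‖ ≤
              |K| * M * S * cellAbsorption_gk ‖L‖ (t' - τ) := by
          intro τ hτ
          have hτ0 : τ < 0 := hτ.2.trans ht'0
          have hτθ : τ < θ := hτ.2.trans ht'θ
          have hτt : τ ≤ t := (hτ.2.le.trans ht')
          have h := H3 L (u τ) M S (t' - τ) (hu.continuous_slice hτ0) (hper τ hτθ)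
            (fun z => hu.norm_le_of_mem_Ioo ht'0 hτ z) (fun z => ih τ hτt z) (sub_pos.2 hτ.2) y
          refine h.trans ?_
          have hg0 : 0 ≤ cellAbsorption_gk ‖L‖ (t' - τ) := cellAbsorption_gk_nonneg (sub_pos.2 hτ.2).le
          calc K * min ((t' - τ) ^ (-(1 / 2 : ℝ))) (‖L‖ ^ 2 * (t' - τ) ^ (-(3 / 2 : ℝ))) * M * S
              = K * (cellAbsorption_gk ‖L‖ (t' - τ) * M * S) := by rw [cellAbsorption_gk_def]; ring
            _ ≤ |K| * (cellAbsorption_gk ‖L‖ (t' - τ) * M * S) :=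
                mul_le_mul_of_nonneg_right (le_abs_self K) (by positivity)
            _ = |K| * M * S * cellAbsorption_gk ‖L‖ (t' - τ) := by ring
        -- H3 integrated
        have hB : ‖∫ τ in Ioo s t', (oseenSlice (t' - τ) (u τ) (u τ) y -
            ∫ r in (0:ℝ)..1, oseenSlice (t' - τ) (u τ) (u τ) (y + r • L))‖ ≤
              |K| * M * S * (4 * ‖L‖) := by
          have hgi : IntegrableOn (fun τ => |K| * M * S * cellAbsorption_gk ‖L‖ (t' - τ)) (Ioo s t') :=
            (cellAbsorption_integrableOn_gk_sub ‖L‖ hs).const_mul _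
          calc ‖∫ τ in Ioo s t', (oseenSlice (t' - τ) (u τ) (u τ) y -
                ∫ r in (0:ℝ)..1, oseenSlice (t' - τ) (u τ) (u τ) (y + r • L))‖
              ≤ ∫ τ in Ioo s t', |K| * M * S * cellAbsorption_gk ‖L‖ (t' - τ) := by
                refine norm_integral_le_of_norm_le hgi ?_
                filter_upwards [ae_restrict_mem measurableSet_Ioo] with τ hτ
                exact hN τ hτ
            _ = |K| * M * S * ∫ τ in Ioo s t', cellAbsorption_gk ‖L‖ (t' - τ) := integral_const_mul _ _
            _ ≤ |K| * M * S * (4 * ‖L‖) :=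
                mul_le_mul_of_nonneg_left (cellAbsorption_setIntegral_gk_sub_le hℓ0 hs) (by positivity)
        -- the ratio
        have hratio : |K| * M * S * (4 * ‖L‖) ≤ q ^ (n + 1) * W₀ := by
          have h1 : |K| * M * S * (4 * ‖L‖) = (4 * |K| * ‖L‖ * S) * M := by ring
          have h2 : q ^ (n + 1) * W₀ = (4 * |K| * ‖L‖ * S) * (C / Real.sqrt (-t)) := by
            rw [hS, hq, pow_succ]; ring
          rw [h1, h2]
          exact mul_le_mul_of_nonneg_left (hmono t' ht') (by positivity)
        -- assemble
        have hwrep : w t' y = (heatExtension (u s) (t' - s) y -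
            ∫ r in (0:ℝ)..1, heatExtension (u s) (t' - s) (y + r • L)) -
            ∫ τ in Ioo s t', (oseenSlice (t' - τ) (u τ) (u τ) y -
              ∫ r in (0:ℝ)..1, oseenSlice (t' - τ) (u τ) (u τ) (y + r • L)) := hrep
        rw [hwrep]
        exact (norm_sub_le _ _).trans (add_le_add hA (hB.trans hratio))
      -- let `s → -∞`
      have hlim : Tendsto (fun s => ε s + q ^ (n + 1) * W₀) atBot (𝓝 (0 + q ^ (n + 1) * W₀)) :=
        hεlim.add tendsto_const_nhds
      have := ge_of_tendsto hlim ((eventually_lt_atBot t').mono fun s hs => hbound s hs)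
      simpa using this
  -- the oscillation vanishes at time `t`
  have hzero : ∀ y, w t y = 0 := by
    intro y
    have hlim : Tendsto (fun n : ℕ => q ^ n * W₀) atTop (𝓝 (0 * W₀)) :=
      (tendsto_pow_atTop_nhds_zero_of_lt_one hq0 (by linarith)).mul_const W₀
    rw [zero_mul] at hlim
    have h := ge_of_tendsto hlim (Eventually.of_forall fun n => claim n t le_rfl y)
    exact norm_le_zero_iff.1 h
  have hmean : ∀ y, u t y = ∫ r in (0:ℝ)..1, u t (y + r • L) := fun y =>
    sub_eq_zero.1 (hzero y)
  rw [hmean (x₀ + s₀ • L), hmean x₀]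
  exact cellAbsorption_mean_transl (hper t ht) x₀ s₀

end Summit.NavierStokesRegularity.NavierStokesRegularity.Theorems

end
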